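import Summits.BirchSwinnertonDyer.BirchSwinnertonDyer.Theorems.PrintCFramBottomClassIndexLawFiveLeCutFormCohenProduct
import Summits.BirchSwinnertonDyer.BirchSwinnertonDyer.Theorems.PrintCFramBottomClassIndexLawFiveLeCutFormPeriodicCut
import Summits.BirchSwinnertonDyer.BirchSwinnertonDyer.Theorems.PrintCFramBottomClassIndexLawFiveLeCuspSeedAbelResidue
import Summits.BirchSwinnertonDyer.BirchSwinnertonDyer.Theorems.PrintCFramBottomClassIndexLawFiveLeCuspSeedAbelLimit
import Summits.BirchSwinnertonDyer.BirchSwinnertonDyer.Theorems.PrintCFramBottomClassIndexLawFiveLeCuspSeedQExpansionPrincipleAtZero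
import Mathlib.Analysis.Normed.Ring.InfiniteSum
import HarnessLib

set_option autoImplicit false

/-!
# Crux `PrintCFram.BottomClassIndexLawFiveLe` (stmt-BirchSwinnertonDyer-20372), line `eisenstein-resource-bdp-line` (registry v24):
# CUSP-GLUE (δ) — THE CUSP VEHICLE `F = F_e · θ((24m²)²·)` OF `stub_cuspCutForm` (iii): a modular form of weight `k + 1` on
# `Γ₁(4·(24m²)⁴)` whose q-expansion is the Cauchy product (cut Cohen numbers) ⋆ (theta coefficients), its factorisation on the
# imaginary axis, its cusp-`0` constant as an Abel limit (Lemma A), and the `ℤ̄[1/N]`-bookkeeping of its coefficients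
# (cell `bsd-print-cfram`, width seat `bsd-line-cfram-p1-w8` g8; THEOREMS ONLY, `--supports` 20372; BSD is not proved by any of this)

HONEST FRAMING. Nothing here is a statement about elliptic curves or BSD; no registered stub is closed. CONDITIONAL on the
cite-only named fact NF-A `Cohen1975.thm31_cohenSeries_mem_halfIntModularForms` (Cohen 1975 Thm 3.1), exactly like the AT-`p`
rung's `CutFormAssembly` (LEAD g13, p695510), of which this is the exponent-`1` twin for the CUSP rung: from seat w8 g7's
`HalfIntegralBridge.exists_modularForm_cohen_mul_thetaMul_sq_pow_qExpansion` (`H_k · θ(Q²·) ∈ ModularForm (Γ₁(4Q²)) (k+1)`,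
rational q-expansion `(Σ H(k,N)qᴺ)·Θ`) at `Q = 24m²` and seat w3 g12's periodic cut `CutForm.exists_modularForm_gamma1_qExpansion_cuspCut`
(the (3,0)-`m`-cut of registry v24's `stub_cuspCutForm`, period `24m²`) with `PowerSeries.coeff_mul_of_periodic_support`
(«cut(H·Θ) = cut(H)·Θ», `Θ` supported on multiples of `(24m²)²`), we get **the cusp vehicle** `F` (`exists_cuspVehicle`):
(i) `coeff n (qExpansion 1 F) = Σ_{a+b=n} h(a)·r(b)` with `h = 𝟙_cut · H(k,·) ∈ ℚ` and `r ∈ ℕ` the q-coefficients of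
`θ((24m²)²·)` (`ThetaQExpansion.hasSum_thetaMul_nat`); (ii) ON THE IMAGINARY AXIS `F(iy) = (Σ' h(n) e^{−2πny}) · θ_{(24m²)²}(iy)`
(Cauchy product of absolutely convergent series; the summability of the cut Cohen series is taken from ONE `LSeriesSummable`
hypothesis — the same currency as (E4)'s `hsum`); (iii) LEMMA A for `F` at the cusp `0`: `y^{k+1}F(iy) → i^{k+1}·valueAtInfty (F ∣ S)`
(p691154, with the `Γ(N)`-form `F ∣ S` of `CuspGlue.exists_modularForm_gamma_coe_eq_slash`); and §3 the `ℤ̄[1/N]`-BOOKKEEPING: if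
every cut number satisfies seat w7 g6's (INT) socket «`∃ j (z : ℤ), N^j · (A·H(k,a)/p) = z`» then every coefficient of `A • F` is
`p·y` with `y ∈ ℤ̄[1/N]` — the hypothesis `hcoef` of `CuspGlue.exists_isIntegral_valueAtInfty_slash_of_qExpansion_one` (NF-Q at the cusp
`0`, p-file `…CuspSeedQExpansionPrincipleAtZero`), together with `valueAtInfty ((A • F) ∣ S) = A · valueAtInfty (F ∣ S)`.
With (α) `CuspGlue.tendsto_rpow_smul_tsum_of_eq_mul_thetaMul` (ii)+(iii) give (E4)'s `hlim` for `a = h`, `w = k + 1/2`.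
beyond-print theorem: NO.

References: [Cohen1975] Thm. 3.1; [DiamondShurman2005] §1.1–1.2; crux notes `Lines/eisenstein-resource-bdp-line-w5g5-cusp-seed.md`
§§2, 14–15; `Lines/eisenstein-resource-bdp-line-w8g6-notes.md` §3.2.
-/

-- summit-side namespace `Summit.BirchSwinnertonDyer.BirchSwinnertonDyer.…` (single-conjunct summit, D-0017 layout)
set_option linter.dupNamespace false

noncomputable section

open scoped Classical MatrixGroups NumberTheorySymbols ModularForm Manifold Topology Real

open UpperHalfPlane hiding I
open Complex Filter Function PowerSeries
open Literature.NumberTheory.EllipticCurves.ModularForms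

namespace Summit.BirchSwinnertonDyer.BirchSwinnertonDyer.Theorems.PrintCFram.CuspGlue

open Summit.BirchSwinnertonDyer.BirchSwinnertonDyer.Theorems.PrintCFram
open Literature.NumberTheory.EllipticCurves.Tunnell1983
open Literature.NumberTheory.ModularForms.CohenEisenstein (cohenH)
open Literature.NumberTheory.ModularForms

/-! ## §1 q-series on the imaginary axis -/

/-- `𝕢_1(iy)^n = e^{−2πny}` for `y > 0`. [folklore] -/
theorem qParam_one_ofComplex_I_mul_pow {y : ℝ} (hy : 0 < y) (n : ℕ) :
    Periodic.qParam 1 (((ofComplex (I * y) : ℍ)) : ℂ) ^ n = (Real.exp (-(2 * π * n * y)) : ℂ) := by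
  have hpos : 0 < (I * (y : ℂ)).im := by
    rw [mul_comm, Complex.im_ofReal_mul, Complex.I_im, mul_one]; exact hy
  rw [ofComplex_apply_of_im_pos hpos, coe_mk, Periodic.qParam, Complex.ofReal_one, div_one, ← Complex.exp_nat_mul,
    Complex.ofReal_exp]
  congr 1
  push_cast
  have : I * I = -1 := Complex.I_mul_I
  linear_combination (2 * (π : ℂ) * (n : ℂ) * (y : ℂ)) * this

/-- **Cauchy product on the imaginary axis.** If `F(iy) = Σ c(n) e^{−2πny}`, `θ(iy) = Σ r(n) e^{−2πny}` with `r ≥ 0` real,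
`c = h ⋆ r` (Cauchy product) and `Σ ‖h n‖ e^{−2πny} < ∞`, then `F(iy) = (Σ' h(n) e^{−2πny}) · θ(iy)`. [folklore] -/
theorem eq_tsum_mul_of_hasSum_cauchy {Fy θy : ℂ} {c h : ℕ → ℂ} {r : ℕ → ℝ} {y : ℝ}
    (hF : HasSum (fun n ↦ c n * (Real.exp (-(2 * π * n * y)) : ℂ)) Fy)
    (hθ : HasSum (fun n ↦ (r n : ℂ) * (Real.exp (-(2 * π * n * y)) : ℂ)) θy) (hr : ∀ n, 0 ≤ r n)
    (hc : ∀ n, c n = ∑ ij ∈ Finset.HasAntidiagonal.antidiagonal n, h ij.1 * r ij.2)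
    (hh : Summable fun n ↦ ‖h n‖ * Real.exp (-(2 * π * n * y))) :
    Fy = (∑' n, h n * (Real.exp (-(2 * π * n * y)) : ℂ)) * θy := by
  have h1 : Summable fun n ↦ ‖h n * (Real.exp (-(2 * π * n * y)) : ℂ)‖ := by
    refine hh.congr fun n ↦ ?_
    rw [norm_mul, Complex.norm_real, Real.norm_of_nonneg (Real.exp_pos _).le]
  have h2 : Summable fun n ↦ ‖(r n : ℂ) * (Real.exp (-(2 * π * n * y)) : ℂ)‖ := by
    have hre : HasSum (fun n ↦ r n * Real.exp (-(2 * π * n * y))) θy.re := by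
      have := Complex.hasSum_re hθ
      refine this.congr_fun fun n ↦ ?_
      show r n * Real.exp (-(2 * π * n * y)) = ((r n : ℂ) * (Real.exp (-(2 * π * n * y)) : ℂ)).re
      rw [← Complex.ofReal_mul, Complex.ofReal_re]
    refine hre.summable.congr fun n ↦ ?_
    rw [← Complex.ofReal_mul, Complex.norm_real, Real.norm_of_nonneg (mul_nonneg (hr n) (Real.exp_pos _).le)]
  rw [← hθ.tsum_eq, tsum_mul_tsum_eq_tsum_sum_antidiagonal_of_summable_norm h1 h2, ← hF.tsum_eq]
  refine tsum_congr fun n ↦ ?_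
  rw [hc n, Finset.sum_mul]
  refine Finset.sum_congr rfl fun ij hij ↦ ?_
  rw [Finset.HasAntidiagonal.mem_antidiagonal] at hij
  have hexp : (Real.exp (-(2 * π * n * y)) : ℂ) =
      (Real.exp (-(2 * π * ij.1 * y)) : ℂ) * (Real.exp (-(2 * π * ij.2 * y)) : ℂ) := by
    rw [← Complex.ofReal_mul, ← Real.exp_add, ← hij]
    push_cast
    ring_nf
  rw [hexp]
  ring

/-! ## §2 The cusp vehicle -/

/-- **THE CUSP VEHICLE of `stub_cuspCutForm` (iii).** Assume NF-A (Cohen 1975 Thm 3.1, cite-only). For `m ≥ 1`, `k ≥ 2`, put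
`Q₁ = 24m²` and let `h(a) = H(k,a)` on the (3,0)-`m`-cut {`m·n'` : `n' ≡ 3 (4)`, `J(−n'|q) = 1` for odd primes `q ∣ m`,
`n' ≡ 7 (8)` if `2 ∣ m`, `3 ∤ n'`} and `h(a) = 0` off it. If the cut series `Σ h(n) n^{−s}` converges for SOME real `s`, there are a
modular form `F` of weight `k+1` on `Γ₁(4Q₁²·Q₁²)` and `r : ℕ → ℕ` (the q-coefficients of `θ(Q₁²·)`: `r 0 = 1`, support in
`{Q₁²j²}`, `θ_{Q₁²}(τ) = Σ r(n) 𝕢_1(τ)ⁿ`) with: (i) `coeff n (qExpansion 1 F) = Σ_{a+b=n} h(a) r(b)` (rational); (ii)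
`F(iy) = (Σ' h(n)e^{−2πny}) · θ_{Q₁²}(iy)` for `y > 0`; (iii) `y^{k+1}F(iy) → i^{k+1} · valueAtInfty (F ∣_{k+1} S)` as `y → 0⁺`.
[cite: Cohen1975, Thm. 3.1] -/
theorem exists_cuspVehicle (hA : Cohen1975.thm31_cohenSeries_mem_halfIntModularForms) {m : ℕ} (hm : 0 < m)
    {k : ℕ} (hk : 2 ≤ k)
    (hsum : ∃ s : ℝ, LSeriesSummable (fun a : ℕ ↦ if (m ∣ a ∧ a / m % 4 = 3 ∧
        (∀ q : ℕ, q.Prime → q ∣ m → q ≠ 2 → jacobiSym (-((a / m : ℕ) : ℤ)) q = 1) ∧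
        (2 ∣ m → a / m % 8 = 7) ∧ ¬ 3 ∣ a / m) then ((cohenH k a : ℚ) : ℂ) else 0) s) :
    ∃ (F : ModularForm (CongruenceSubgroup.Gamma1 (4 * (24 * m ^ 2) ^ 2 * (24 * m ^ 2) ^ 2)) ((k + 1 : ℕ) : ℤ)) (r : ℕ → ℕ),
      r 0 = 1 ∧ (∀ n : ℕ, r n ≠ 0 → ∃ j : ℕ, n = (24 * m ^ 2) ^ 2 * j ^ 2) ∧
      (∀ τ : ℍ, HasSum (fun n : ℕ ↦ (r n : ℂ) * Periodic.qParam 1 τ ^ n) (thetaMul ((24 * m ^ 2) ^ 2) τ)) ∧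
      (∀ n : ℕ, (qExpansion 1 ⇑F).coeff n =
        ((∑ ij ∈ Finset.HasAntidiagonal.antidiagonal n, (if (m ∣ ij.1 ∧ ij.1 / m % 4 = 3 ∧
            (∀ q : ℕ, q.Prime → q ∣ m → q ≠ 2 → jacobiSym (-((ij.1 / m : ℕ) : ℤ)) q = 1) ∧
            (2 ∣ m → ij.1 / m % 8 = 7) ∧ ¬ 3 ∣ ij.1 / m) then cohenH k ij.1 else 0) * (r ij.2 : ℚ) : ℚ) : ℂ)) ∧
      (∀ y : ℝ, 0 < y → F (ofComplex (I * y)) =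
        (∑' n : ℕ, (if (m ∣ n ∧ n / m % 4 = 3 ∧
            (∀ q : ℕ, q.Prime → q ∣ m → q ≠ 2 → jacobiSym (-((n / m : ℕ) : ℤ)) q = 1) ∧
            (2 ∣ m → n / m % 8 = 7) ∧ ¬ 3 ∣ n / m) then ((cohenH k n : ℚ) : ℂ) else 0) *
          (Real.exp (-(2 * π * n * y)) : ℂ)) * thetaMul ((24 * m ^ 2) ^ 2) (ofComplex (I * y))) ∧
      Tendsto (fun y : ℝ ↦ (y : ℂ) ^ ((k + 1 : ℕ) : ℤ) * F (ofComplex (I * y))) (𝓝[>] (0 : ℝ))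
        (𝓝 (I ^ ((k + 1 : ℕ) : ℤ) * valueAtInfty (⇑F ∣[((k + 1 : ℕ) : ℤ)] ModularGroup.S))) := by
  -- abbreviations
  set Q₁ : ℕ := 24 * m ^ 2 with hQ₁
  have hQ₁pos : 0 < Q₁ := by rw [hQ₁]; positivity
  haveI : NeZero (4 * Q₁ ^ 2) := ⟨by positivity⟩
  haveI : NeZero (4 * Q₁ ^ 2 * Q₁ ^ 2) := ⟨by positivity⟩
  set S : ℕ → Prop := fun a ↦ m ∣ a ∧ a / m % 4 = 3 ∧
      (∀ q : ℕ, q.Prime → q ∣ m → q ≠ 2 → jacobiSym (-((a / m : ℕ) : ℤ)) q = 1) ∧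
      (2 ∣ m → a / m % 8 = 7) ∧ ¬ 3 ∣ a / m with hS
  -- (1) the Cohen form (NF-A) and the level-4Q₁² form `f = H · θ(Q₁²·)` of weight k+1
  obtain ⟨H, hH, hHq⟩ := hA k hk
  have hH' := HalfIntegralBridge.mem_halfIntModularForms_of_dvd (dvd_mul_right 4 (Q₁ ^ 2)) hH
  obtain ⟨f, hf⟩ : ∃ f : ModularForm (CongruenceSubgroup.Gamma1 (4 * Q₁ ^ 2)) ((k + 1 : ℕ) : ℤ),
      ⇑f = H * thetaMul (Q₁ ^ 2) ^ 1 :=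
    HalfIntegralBridge.exists_modularForm_mul_thetaMul_sq_pow hQ₁pos (dvd_refl _) odd_one hH'
  -- the theta q-series
  obtain ⟨Θ, hΘq, hΘ0, hΘsupp⟩ := HalfIntegralBridge.exists_powerSeries_nat_qExpansion_thetaMul (pow_pos hQ₁pos 2)
  set r : ℕ → ℕ := fun n ↦ PowerSeries.coeff n Θ with hr
  have hrq : ∀ n : ℕ, qCoeffs (thetaMul (Q₁ ^ 2)) n = (r n : ℂ) := fun n ↦ by
    rw [qCoeffs_apply, hΘq, PowerSeries.coeff_map]; rfl
  have hrsum : ∀ τ : ℍ, HasSum (fun n : ℕ ↦ (r n : ℂ) * Periodic.qParam 1 τ ^ n) (thetaMul (Q₁ ^ 2) τ) := by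
    intro τ
    have := hasSum_qCoeffs (HalfIntegralBridge.thetaMul_sq_mem_halfIntModularForms hQ₁pos) τ
    simpa only [hrq] using this
  -- q-expansion of `f`: `(Σ H(k,n) qⁿ) · Θ`
  have hfq : ∀ n : ℕ, (qExpansion 1 ⇑f).coeff n =
      ∑ ij ∈ Finset.HasAntidiagonal.antidiagonal n, ((cohenH k ij.1 : ℚ) : ℂ) * (r ij.2 : ℂ) := by
    intro n
    rw [hf, HalfIntegralBridge.qExpansion_mul_thetaMul_sq_pow hH' hQ₁pos 1, pow_one, hΘq, PowerSeries.coeff_mul]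
    refine Finset.sum_congr rfl fun ij _ ↦ ?_
    rw [← qCoeffs_apply, hHq, PowerSeries.coeff_map]
    rfl
  -- (2) the (3,0)-cut of `f` (w3 g12)
  obtain ⟨F, hFon, hFoff⟩ := CutForm.exists_modularForm_gamma1_qExpansion_cuspCut f m hm
  -- the cut is Q₁-periodic and `Θ` is supported on multiples of Q₁
  have hSper : Function.Periodic S Q₁ := by
    intro a
    have := CutForm.cuspCutIndex_add_iff m a 1 hm
    simp only [mul_one] at this
    rw [hS]
    exact propext this
  have hΘQ : ∀ j : ℕ, PowerSeries.coeff j (Θ.map (Nat.castRingHom ℂ)) ≠ 0 → Q₁ ∣ j := by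
    intro j hj
    rw [PowerSeries.coeff_map] at hj
    have hj' : PowerSeries.coeff j Θ ≠ 0 := fun h0 ↦ hj (by rw [h0, map_zero])
    obtain ⟨i, hi⟩ := hΘsupp j hj'
    exact ⟨Q₁ * i ^ 2, by rw [hi]; ring⟩
  -- (i) the q-expansion of `F` is `cut(H) · Θ`
  set ψ : PowerSeries ℂ := PowerSeries.mk fun a ↦ if S a then ((cohenH k a : ℚ) : ℂ) else 0 with hψ
  have hcutq : ∀ n : ℕ, (qExpansion 1 ⇑F).coeff n =
      PowerSeries.coeff n (ψ * Θ.map (Nat.castRingHom ℂ)) := by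
    intro n
    have hfq' : qExpansion 1 ⇑f = qExpansion 1 H * Θ.map (Nat.castRingHom ℂ) := by
      rw [hf, HalfIntegralBridge.qExpansion_mul_thetaMul_sq_pow hH' hQ₁pos 1, pow_one, hΘq]
    have key := PowerSeries.coeff_mul_of_periodic_support hSper (φ := qExpansion 1 H) (ψ := ψ)
      (T := Θ.map (Nat.castRingHom ℂ)) (fun a ha ↦ by rw [hψ, PowerSeries.coeff_mk, if_pos ha, ← hHq, qCoeffs_apply])
      (fun a ha ↦ by rw [hψ, PowerSeries.coeff_mk, if_neg ha]) hΘQ n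
    by_cases hn : S n
    · rw [hFon n hn, key.1 hn, hfq']
    · rw [hFoff n hn, key.2 hn]
  have hcoef : ∀ n : ℕ, (qExpansion 1 ⇑F).coeff n =
      ((∑ ij ∈ Finset.HasAntidiagonal.antidiagonal n, (if S ij.1 then cohenH k ij.1 else 0) * (r ij.2 : ℚ) : ℚ) : ℂ) := by
    intro n
    rw [hcutq n, PowerSeries.coeff_mul]
    push_cast
    refine Finset.sum_congr rfl fun ij _ ↦ ?_
    rw [hψ, PowerSeries.coeff_mk, PowerSeries.coeff_map]
    by_cases h : S ij.1 <;> simp [h, hr]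
  -- (ii) the factorisation on the imaginary axis
  have h1per : (1 : ℝ) ∈ (CongruenceSubgroup.Gamma1 (4 * Q₁ ^ 2 * Q₁ ^ 2) : Subgroup (GL (Fin 2) ℝ)).strictPeriods := by
    rw [CongruenceSubgroup.strictPeriods_Gamma1]; exact AddSubgroup.mem_zmultiples _
  have hFsum : ∀ τ : ℍ, HasSum (fun n : ℕ ↦ (qExpansion 1 ⇑F).coeff n * Periodic.qParam 1 τ ^ n) (F τ) := by
    intro τ
    simpa [smul_eq_mul] using hasSum_qExpansion one_pos (SlashInvariantFormClass.periodic_comp_ofComplex F h1per)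
      F.holo' (ModularFormClass.bdd_at_infty F) τ
  obtain ⟨s₀, hs₀⟩ := hsum
  have hfact : ∀ y : ℝ, 0 < y → F (ofComplex (I * y)) =
      (∑' n : ℕ, (if S n then ((cohenH k n : ℚ) : ℂ) else 0) * (Real.exp (-(2 * π * n * y)) : ℂ)) *
        thetaMul (Q₁ ^ 2) (ofComplex (I * y)) := by
    intro y hy
    refine eq_tsum_mul_of_hasSum_cauchy (c := fun n ↦ (qExpansion 1 ⇑F).coeff n) (r := fun n ↦ (r n : ℝ))
      (h := fun n ↦ if S n then ((cohenH k n : ℚ) : ℂ) else 0) ?_ ?_ (fun n ↦ Nat.cast_nonneg _) ?_ ?_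
    · have := hFsum (ofComplex (I * y))
      simpa only [qParam_one_ofComplex_I_mul_pow hy] using this
    · have := hrsum (ofComplex (I * y))
      simpa only [qParam_one_ofComplex_I_mul_pow hy, Complex.ofReal_natCast] using this
    · intro n
      rw [hcoef n]
      push_cast
      refine Finset.sum_congr rfl fun ij _ ↦ ?_
      by_cases h : S ij.1 <;> simp [h]
    · exact CuspSeed.summable_norm_mul_exp_of_LSeriesSummable hs₀ hy
  -- (iii) Lemma A for `F` at the cusp 0: the `Γ(N)`-form `F ∣ S`
  obtain ⟨G, hG⟩ := exists_modularForm_gamma_coe_eq_of_gamma1 F (dvd_refl (4 * Q₁ ^ 2 * Q₁ ^ 2))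
  obtain ⟨GS, hGS⟩ := exists_modularForm_gamma_coe_eq_slash G ModularGroup.S
  have hNper : ((4 * Q₁ ^ 2 * Q₁ ^ 2 : ℕ) : ℝ) ∈ (CongruenceSubgroup.Gamma (4 * Q₁ ^ 2 * Q₁ ^ 2) : Subgroup (GL (Fin 2) ℝ)).strictPeriods := by
    rw [CongruenceSubgroup.strictPeriods_Gamma]; exact AddSubgroup.mem_zmultiples _
  have hLemmaA := CuspSeed.tendsto_zpow_mul_apply_ofComplex_I_mul (F := ⇑F) (k := ((k + 1 : ℕ) : ℤ))
    (h := ((4 * Q₁ ^ 2 * Q₁ ^ 2 : ℕ) : ℝ)) (by positivity)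
    (by rw [← hG, ← hGS]; exact SlashInvariantFormClass.periodic_comp_ofComplex GS hNper)
    (by rw [← hG, ← hGS]; exact GS.holo')
    (by rw [← hG, ← hGS]; exact ModularFormClass.bdd_at_infty GS)
  exact ⟨F, r, hΘ0, hΘsupp, hrsum, hcoef, hfact, hLemmaA⟩

/-! ## §3 The `ℤ̄[1/N]`-bookkeeping of the coefficients and the scalar `A` -/

/-- `ℤ̄[1/N]` (as the set of `y ∈ ℂ` with `N^j·y` integral over `ℤ` for some `j`) is closed under addition. [folklore] -/
theorem exists_isIntegral_pow_mul_add {N : ℕ} {x y : ℂ} (hx : ∃ j : ℕ, IsIntegral ℤ ((N : ℂ) ^ j * x))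
    (hy : ∃ j : ℕ, IsIntegral ℤ ((N : ℂ) ^ j * y)) : ∃ j : ℕ, IsIntegral ℤ ((N : ℂ) ^ j * (x + y)) := by
  obtain ⟨i, hi⟩ := hx
  obtain ⟨j, hj⟩ := hy
  refine ⟨i + j, ?_⟩
  have e : (N : ℂ) ^ (i + j) * (x + y) = (N : ℂ) ^ j * ((N : ℂ) ^ i * x) + (N : ℂ) ^ i * ((N : ℂ) ^ j * y) := by ring
  rw [e]
  exact ((isIntegral_natCast _).pow _ |>.mul hi).add ((isIntegral_natCast _).pow _ |>.mul hj)

/-- `ℤ̄[1/N]` is closed under finite sums. [folklore] -/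
theorem exists_isIntegral_pow_mul_sum {N : ℕ} {ι : Type*} (s : Finset ι) (g : ι → ℂ)
    (hg : ∀ i ∈ s, ∃ j : ℕ, IsIntegral ℤ ((N : ℂ) ^ j * g i)) :
    ∃ j : ℕ, IsIntegral ℤ ((N : ℂ) ^ j * ∑ i ∈ s, g i) := by
  induction s using Finset.induction_on with
  | empty => exact ⟨0, by simpa using isIntegral_zero⟩
  | insert a s ha ih =>
    rw [Finset.sum_insert ha]
    exact exists_isIntegral_pow_mul_add (hg a (Finset.mem_insert_self a s))
      (ih fun i hi ↦ hg i (Finset.mem_insert_of_mem hi))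

/-- A rational `q` with `N^j · q ∈ ℤ`, times a natural number, lies in `ℤ̄[1/N]`. [folklore] -/
theorem exists_isIntegral_pow_mul_ratCast_mul_natCast {N : ℕ} {q : ℚ} (hq : ∃ (j : ℕ) (z : ℤ), (N : ℚ) ^ j * q = z)
    (b : ℕ) : ∃ j : ℕ, IsIntegral ℤ ((N : ℂ) ^ j * ((q : ℂ) * (b : ℂ))) := by
  obtain ⟨j, z, hz⟩ := hq
  refine ⟨j, ?_⟩
  have e : (N : ℂ) ^ j * ((q : ℂ) * (b : ℂ)) = ((z * b : ℤ) : ℂ) := by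
    have : (((N : ℚ) ^ j * q : ℚ) : ℂ) = ((z : ℚ) : ℂ) := by rw [hz]
    push_cast at this ⊢
    rw [← mul_assoc, this]
  rw [e]
  exact isIntegral_intCast _

/-- ADAPTER from seat w7 g6's (INT) currency: if `h = p·y` with `2^j·y ∈ ℤ` (`CohenCut.exists_eq_prime_mul_cohenH_of_cut_of_norm_lt_one`)
and `2 ∣ N`, then `N^j·(A·h/p) ∈ ℤ` for every natural `A`. [folklore] -/
theorem exists_pow_mul_div_eq_intCast_of_two_pow {N p A : ℕ} (hN : 2 ∣ N) (hp : p ≠ 0) {h y : ℚ} {j : ℕ} {z : ℤ}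
    (hy : h = p * y) (hz : (2 : ℚ) ^ j * y = z) : ∃ (j' : ℕ) (z' : ℤ), (N : ℚ) ^ j' * (A * h / p) = z' := by
  obtain ⟨M, rfl⟩ := hN
  refine ⟨j, A * M ^ j * z, ?_⟩
  have hp' : (p : ℚ) ≠ 0 := by exact_mod_cast hp
  rw [hy, show (A : ℚ) * (p * y) / p = A * y by field_simp]
  push_cast
  rw [← hz, mul_pow]
  ring

/-- **The coefficients of `A • F` lie in `p · ℤ̄[1/N]`.** If `coeff n (qExpansion 1 F) = Σ_{a+b=n} h(a)·r(b)` with `h ∈ ℚ`,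
`r ∈ ℕ`, and every NON-ZERO `h(a)` satisfies seat w7 g6's (INT) socket «`∃ j (z : ℤ), N^j · (A·h(a)/p) = z`» (for the cut Cohen
numbers: `A = 1` when `m ≠ 1`, via `exists_pow_mul_div_eq_intCast_of_two_pow`), then every coefficient of `qExpansion 1 ((A:ℝ) • F)` is
`p·y` with `N^j·y` integral over `ℤ` — the hypothesis `hcoef` of `CuspGlue.exists_isIntegral_valueAtInfty_slash_of_qExpansion_one` for
the form `(A:ℝ) • F` with `d = p`. [folklore] -/
theorem qExpansion_smul_coeff_mem {L : ℕ} [NeZero L] {κ : ℤ} (F : ModularForm (CongruenceSubgroup.Gamma1 L) κ) {h : ℕ → ℚ}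
    {r : ℕ → ℕ}
    (hcoef : ∀ n : ℕ, (qExpansion 1 ⇑F).coeff n =
      ((∑ ij ∈ Finset.HasAntidiagonal.antidiagonal n, h ij.1 * (r ij.2 : ℚ) : ℚ) : ℂ))
    {A p N : ℕ} (hINT : ∀ a : ℕ, h a ≠ 0 → ∃ (j : ℕ) (z : ℤ), (N : ℚ) ^ j * (A * h a / p) = z) (hp : p ≠ 0) :
    ∀ n : ℕ, ∃ y : ℂ, (∃ j : ℕ, IsIntegral ℤ ((N : ℂ) ^ j * y)) ∧
      (qExpansion 1 ⇑((A : ℝ) • F)).coeff n = (p : ℂ) * y := by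
  have hINT' : ∀ a : ℕ, ∃ (j : ℕ) (z : ℤ), (N : ℚ) ^ j * (A * h a / p) = z := by
    intro a
    by_cases ha : h a = 0
    · exact ⟨0, 0, by simp [ha]⟩
    · exact hINT a ha
  intro n
  have h1per : (1 : ℝ) ∈ (CongruenceSubgroup.Gamma1 L : Subgroup (GL (Fin 2) ℝ)).strictPeriods := by
    rw [CongruenceSubgroup.strictPeriods_Gamma1]; exact AddSubgroup.mem_zmultiples _
  have hsmul : qExpansion 1 ⇑((A : ℝ) • F) = (A : ℂ) • qExpansion 1 ⇑F := by
    have hcoe : ⇑((A : ℝ) • F) = (A : ℂ) • ⇑F := by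
      funext τ
      simp only [ModularForm.coe_smul, Pi.smul_apply, Complex.real_smul, smul_eq_mul, Complex.ofReal_natCast]
    rw [hcoe]
    exact qExpansion_smul (ModularFormClass.analyticAt_cuspFunction_zero F one_pos h1per) (A : ℂ)
  refine ⟨∑ ij ∈ Finset.HasAntidiagonal.antidiagonal n, ((A * h ij.1 / p : ℚ) : ℂ) * (r ij.2 : ℂ), ?_, ?_⟩
  · exact exists_isIntegral_pow_mul_sum _ _ fun ij _ ↦ exists_isIntegral_pow_mul_ratCast_mul_natCast (hINT' ij.1) _
  · rw [hsmul, map_smul, hcoef n, smul_eq_mul, Finset.mul_sum]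
    push_cast
    rw [Finset.mul_sum]
    refine Finset.sum_congr rfl fun ij _ ↦ ?_
    have hp' : (p : ℂ) ≠ 0 := by exact_mod_cast hp
    field_simp

/-- **`valueAtInfty ((A • F) ∣ S) = A · valueAtInfty (F ∣ S)`** for a modular form `F` on `Γ₁(L)` (the value at the cusp `0`
is linear). [folklore] -/
theorem valueAtInfty_smul_slash {L : ℕ} [NeZero L] {κ : ℤ} (F : ModularForm (CongruenceSubgroup.Gamma1 L) κ) (A : ℝ) :
    valueAtInfty (⇑(A • F) ∣[κ] ModularGroup.S) = (A : ℂ) * valueAtInfty (⇑F ∣[κ] ModularGroup.S) := by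
  obtain ⟨G, hG⟩ := exists_modularForm_gamma_coe_eq_of_gamma1 F (dvd_refl L)
  obtain ⟨GS, hGS⟩ := exists_modularForm_gamma_coe_eq_slash G ModularGroup.S
  have hNper : ((L : ℕ) : ℝ) ∈ (CongruenceSubgroup.Gamma L : Subgroup (GL (Fin 2) ℝ)).strictPeriods := by
    rw [CongruenceSubgroup.strictPeriods_Gamma]; exact AddSubgroup.mem_zmultiples _
  have hL : (0 : ℝ) < L := by exact_mod_cast Nat.pos_of_ne_zero (NeZero.ne L)
  have hT : Tendsto (⇑F ∣[κ] ModularGroup.S) atImInfty (𝓝 (valueAtInfty (⇑F ∣[κ] ModularGroup.S))) := by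
    rw [← hG, ← hGS]
    exact CuspSeed.tendsto_atImInfty_valueAtInfty hL (SlashInvariantFormClass.periodic_comp_ofComplex GS hNper)
      GS.holo' (ModularFormClass.bdd_at_infty GS)
  have hcoe : ⇑(A • F) ∣[κ] ModularGroup.S = fun τ ↦ (A : ℂ) * (⇑F ∣[κ] ModularGroup.S) τ := by
    rw [ModularForm.coe_smul, ModularForm.SL_smul_slash]
    funext τ
    simp only [Pi.smul_apply, Complex.real_smul]
  rw [hcoe]
  exact (hT.const_mul (A : ℂ)).limUnder_eq

end Summit.BirchSwinnertonDyer.BirchSwinnertonDyer.Theorems.PrintCFram.CuspGlue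

end
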